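import Literature.NumberTheory.Rogawski1990.LocalTransferTorusUnstableJunctionCM        -- ★ p842095 B-p08: the factor-agnostic torus unstable junction (binders `hLL halt hfac`)
import Literature.NumberTheory.Rogawski1990.FinExplicitTransferFactorTorusDockSplit       -- ★ p842204 B-p08: (J2b) `hfac` — `exists_nhds_finExplicitCollection_Δ_dock_eq_mul_rankOneWeight`
import Literature.NumberTheory.Rogawski1990.RankOneUnstableTransferNonsplit              -- ★ p842088 F0P3-p01: the named fact (R1-lc) `RankOneUnstableTransferNonsplit` (ED. 2, `Real.sqrt`)
import HarnessLib

/-!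
# The torus unstable junction CLOSED modulo (R1-lc) and (J2a): binder `hR1` of the S2 torus-singular junction in the frame of `ε_H`

Topic `NumberTheory/Rogawski1990`; namespace `Literature.NumberTheory.Rogawski1990`.  THEOREMS ONLY (no definition, no instance, no notation, no named
fact, no `sorry`).  B-p08 (g27), LEAD word T8-139 (1)(b) for the line «N6nsGerm» (`stub_N6nsS2`).

★ `exists_nhds_finsum_delta_dock_eq_locallyConstant_of_torusTransfer` (p842095) pays F0P2-p02's binder `hR1` of ★
`exists_nhds_stableOrbitalIntegralRel_eq_of_torus_singular_inv` modulo three inputs: the rank-one unstable transfer `hLL` on the torus `C = Z_H(t₀)` for a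
weight `fac`, the κ-alternation (J2a) `halt`, and the explicit-factor split (J2b) `hfac`.  Here the weight is FIXED to print's `Δ_{H∕C} = μ_w(γ₁ − γ₃)⁻¹·D_H` in the
eigenframe `P` of `t₀ := ε_H`, `hLL` is DISCHARGED by the named fact ★ `RankOneUnstableTransferNonsplit` (R1-lc; [LL79] via [Rog90, Prop. 8.2.1 (c)]) taken as the
hypothesis `hR1lc`, with `Reg := IsLocalGRegular L v` (conjugation-stable, implies `U(Φ₂)`-regularity: ★ `isLocalGRegular_conj_iff`, ★ `isRegularElt_fst_snd_of_isLocalGRegular`),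
and `hfac` is DISCHARGED by ★ `exists_nhds_finExplicitCollection_Δ_dock_eq_mul_rankOneWeight` (p842204) — so `hR1` holds modulo (R1-lc) and the single remaining binder
(J2a) `halt` (F0P3-p02's head, landing), for the torus presentation `P dg ht1`, transport `τ` (`hτ1 hτ2 hτC hτc hτreg`: ★ `exists_torusTransport_frame`, A-p19) and
dock `θ z = y·ι_v(z)·y⁻¹` (★ `exists_centralDock_of_fst_eq_smul_one`) supplied BY NAME by the S2 dress.
[cite: Rogawski1990, §8.2 Prop. 8.2.1 (c) pp. 113–115; §4.9 Lemma 4.9.3 p. 56; §4.3 (4.3.1) p. 43] [cite: LabesseLanglands1979, §2]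
-/

noncomputable section

open Set Filter Topology MeasureTheory Measure
open scoped Matrix MatrixGroups

namespace Literature.NumberTheory.Rogawski1990

open Literature.NumberTheory.Automorphic Literature.NumberTheory.Automorphic.UnitaryGroup Literature.NumberTheory.GaloisRepresentations
open _root_.NumberField _root_.IsDedekindDomain

section TorusUnstableClosed

variable (L : Type) [Field L] [NumberField L] [IsCMField L] (H' : Matrix (Fin 3) (Fin 3) L) (v : HeightOneSpectrum (𝓞 ↥(maximalRealSubfield L)))

open scoped Classical in
/-- **THE ↥(Subgroup.centralizer ({εH} : Set (((cmDatum L 2 (Matrix.of fun i j : Fin 2 => if i.val + j.val + 1 = 2 then (1 : L) else 0)).Local v) ×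
      ((cmDatum L 1 (Matrix.of fun i j : Fin 1 => if i.val + j.val + 1 = 1 then (1 : L) else 0)).Local v))))US UNSTABLE JUNCTION, CLOSED MODULO (R1-lc) AND (J2a)** — F0P2-p02's binder `hR1` of ★ `exists_nhds_stableOrbitalIntegralRel_eq_of_torus_singular_inv`
VERBATIM, from: the named fact ★ `RankOneUnstableTransferNonsplit` (`hR1lc`, [LL79] rank-one unstable transfer on the torus `C = Z_H(ε_H)`, weight
`μ_w(γ₁ − γ₃)⁻¹·D_H` in the eigenframe `P`, `Reg := IsLocalGRegular`) for the canonical family `m_H` (`hmH`); the torus presentation of `ε_H = (A, a)` (`hregA`: `A`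
regular; `hP hdg0 hdg01 ht1`); the transport `τ` (`hτc hτreg hτC hτ1 hτ2`); the dock `θ` (`hθ`); the base point `b₀ = ε_H` (`hb₀`); and the κ-alternation (J2a)
`halt`.  Proof: ★ `exists_nhds_finsum_delta_dock_eq_locallyConstant_of_torusTransfer` with `hLL := hR1lc …` and `hfac :=` ★
`exists_nhds_finExplicitCollection_Δ_dock_eq_mul_rankOneWeight`. [cite: Rogawski1990, §8.2 Prop. 8.2.1 (c) pp. 113–115; §4.9 Lemma 4.9.3 p. 56] [cite: LabesseLanglands1979, §2] -/
theorem exists_nhds_finsum_delta_dock_eq_locallyConstant_of_frame (w : PlacesOver L v) (hw : IsCMField.complexConj L • w.1 = w.1)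
    (μ : HeckeCharacter L)
    (hl : ∀ (v : HeightOneSpectrum (𝓞 ↥(maximalRealSubfield L))) (a : (((cmDatum L 2 (Matrix.of fun i j : Fin 2 => if i.val + j.val + 1 = 2 then (1 : L) else 0)).Local v) ×
      ((cmDatum L 1 (Matrix.of fun i j : Fin 1 => if i.val + j.val + 1 = 1 then (1 : L) else 0)).Local v))) (b : ((cmDatum L 3 H').Local v)) (x : (((cmDatum L 2 (Matrix.of fun i j : Fin 2 => if i.val + j.val + 1 = 2 then (1 : L) else 0)).Local v) ×
      ((cmDatum L 1 (Matrix.of fun i j : Fin 1 => if i.val + j.val + 1 = 1 then (1 : L) else 0)).Local v))),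
      finExplicitDelta L v H' (x * a * x⁻¹) μ b = finExplicitDelta L v H' a μ b)
    (hr : ∀ (v : HeightOneSpectrum (𝓞 ↥(maximalRealSubfield L))) (a : (((cmDatum L 2 (Matrix.of fun i j : Fin 2 => if i.val + j.val + 1 = 2 then (1 : L) else 0)).Local v) ×
      ((cmDatum L 1 (Matrix.of fun i j : Fin 1 => if i.val + j.val + 1 = 1 then (1 : L) else 0)).Local v))) (b y : ((cmDatum L 3 H').Local v)),
      finExplicitDelta L v H' a μ (y * b * y⁻¹) = finExplicitDelta L v H' a μ b)
    -- the measure side of (R1-lc): Haar `ν_H`, Borel structures, the canonical family `m_H` on the `G`-regular set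
    [MeasurableSpace (((cmDatum L 2 (Matrix.of fun i j : Fin 2 => if i.val + j.val + 1 = 2 then (1 : L) else 0)).Local v) ×
      ((cmDatum L 1 (Matrix.of fun i j : Fin 1 => if i.val + j.val + 1 = 1 then (1 : L) else 0)).Local v))] [BorelSpace (((cmDatum L 2 (Matrix.of fun i j : Fin 2 => if i.val + j.val + 1 = 2 then (1 : L) else 0)).Local v) ×
      ((cmDatum L 1 (Matrix.of fun i j : Fin 1 => if i.val + j.val + 1 = 1 then (1 : L) else 0)).Local v))] (νH : Measure (((cmDatum L 2 (Matrix.of fun i j : Fin 2 => if i.val + j.val + 1 = 2 then (1 : L) else 0)).Local v) ×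
      ((cmDatum L 1 (Matrix.of fun i j : Fin 1 => if i.val + j.val + 1 = 1 then (1 : L) else 0)).Local v))) [νH.IsHaarMeasure] [νH.IsMulRightInvariant]
    [iZ : ∀ γ : (((cmDatum L 2 (Matrix.of fun i j : Fin 2 => if i.val + j.val + 1 = 2 then (1 : L) else 0)).Local v) ×
      ((cmDatum L 1 (Matrix.of fun i j : Fin 1 => if i.val + j.val + 1 = 1 then (1 : L) else 0)).Local v)), MeasurableSpace ((((cmDatum L 2 (Matrix.of fun i j : Fin 2 => if i.val + j.val + 1 = 2 then (1 : L) else 0)).Local v) ×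
      ((cmDatum L 1 (Matrix.of fun i j : Fin 1 => if i.val + j.val + 1 = 1 then (1 : L) else 0)).Local v)) ⧸ Subgroup.centralizer ({γ} : Set (((cmDatum L 2 (Matrix.of fun i j : Fin 2 => if i.val + j.val + 1 = 2 then (1 : L) else 0)).Local v) ×
      ((cmDatum L 1 (Matrix.of fun i j : Fin 1 => if i.val + j.val + 1 = 1 then (1 : L) else 0)).Local v))))]
    [bZ : ∀ γ : (((cmDatum L 2 (Matrix.of fun i j : Fin 2 => if i.val + j.val + 1 = 2 then (1 : L) else 0)).Local v) ×
      ((cmDatum L 1 (Matrix.of fun i j : Fin 1 => if i.val + j.val + 1 = 1 then (1 : L) else 0)).Local v)), BorelSpace ((((cmDatum L 2 (Matrix.of fun i j : Fin 2 => if i.val + j.val + 1 = 2 then (1 : L) else 0)).Local v) ×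
      ((cmDatum L 1 (Matrix.of fun i j : Fin 1 => if i.val + j.val + 1 = 1 then (1 : L) else 0)).Local v)) ⧸ Subgroup.centralizer ({γ} : Set (((cmDatum L 2 (Matrix.of fun i j : Fin 2 => if i.val + j.val + 1 = 2 then (1 : L) else 0)).Local v) ×
      ((cmDatum L 1 (Matrix.of fun i j : Fin 1 => if i.val + j.val + 1 = 1 then (1 : L) else 0)).Local v))))]
    {mH : OrbitalMeasureFamily (((cmDatum L 2 (Matrix.of fun i j : Fin 2 => if i.val + j.val + 1 = 2 then (1 : L) else 0)).Local v) ×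
      ((cmDatum L 1 (Matrix.of fun i j : Fin 1 => if i.val + j.val + 1 = 1 then (1 : L) else 0)).Local v))} (hmH : mH.IsCanonical (IsLocalGRegular L v) νH)
    -- the named fact (R1-lc)
    (hR1lc : RankOneUnstableTransferNonsplit)
    -- the torus presentation of `ε_H`
    (εH : (((cmDatum L 2 (Matrix.of fun i j : Fin 2 => if i.val + j.val + 1 = 2 then (1 : L) else 0)).Local v) ×
      ((cmDatum L 1 (Matrix.of fun i j : Fin 1 => if i.val + j.val + 1 = 1 then (1 : L) else 0)).Local v))) (hregA : IsRegularElt (εH.1.val : GL (Fin 2) (LocalRing L v)))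
    (P : GL (Fin 2) (LocalRing L v)) (dg : Fin 2 → LocalRing L v)
    (hP : (εH.1.val.val : Matrix (Fin 2) (Fin 2) (LocalRing L v)) * P.val = P.val * Matrix.diagonal dg) (hdg0 : dg 0 = finGammaTwo L v εH) (hdg01 : dg 0 ≠ dg 1)
    (ht1 : ∀ t : ↥(Subgroup.centralizer ({εH} : Set (((cmDatum L 2 (Matrix.of fun i j : Fin 2 => if i.val + j.val + 1 = 2 then (1 : L) else 0)).Local v) ×
      ((cmDatum L 1 (Matrix.of fun i j : Fin 1 => if i.val + j.val + 1 = 1 then (1 : L) else 0)).Local v)))),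
      (t.1.1.val.val : Matrix (Fin 2) (Fin 2) (LocalRing L v)) * P.val = P.val * Matrix.diagonal ![(P⁻¹.val * t.1.1.val.val * P.val) 0 0, (P⁻¹.val * t.1.1.val.val * P.val) 1 1])
    -- the transport `τ`
    (τ : ↥(Subgroup.centralizer ({εH} : Set (((cmDatum L 2 (Matrix.of fun i j : Fin 2 => if i.val + j.val + 1 = 2 then (1 : L) else 0)).Local v) ×
      ((cmDatum L 1 (Matrix.of fun i j : Fin 1 => if i.val + j.val + 1 = 1 then (1 : L) else 0)).Local v)))) → (((cmDatum L 2 (Matrix.of fun i j : Fin 2 => if i.val + j.val + 1 = 2 then (1 : L) else 0)).Local v) ×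
      ((cmDatum L 1 (Matrix.of fun i j : Fin 1 => if i.val + j.val + 1 = 1 then (1 : L) else 0)).Local v))) (hτc : Continuous τ)
    (hτreg : ∀ t : ↥(Subgroup.centralizer ({εH} : Set (((cmDatum L 2 (Matrix.of fun i j : Fin 2 => if i.val + j.val + 1 = 2 then (1 : L) else 0)).Local v) ×
      ((cmDatum L 1 (Matrix.of fun i j : Fin 1 => if i.val + j.val + 1 = 1 then (1 : L) else 0)).Local v)))), IsLocalGRegular L v (t : (((cmDatum L 2 (Matrix.of fun i j : Fin 2 => if i.val + j.val + 1 = 2 then (1 : L) else 0)).Local v) ×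
      ((cmDatum L 1 (Matrix.of fun i j : Fin 1 => if i.val + j.val + 1 = 1 then (1 : L) else 0)).Local v))) → IsLocalGRegular L v (τ t))
    (hτC : ∀ t : ↥(Subgroup.centralizer ({εH} : Set (((cmDatum L 2 (Matrix.of fun i j : Fin 2 => if i.val + j.val + 1 = 2 then (1 : L) else 0)).Local v) ×
      ((cmDatum L 1 (Matrix.of fun i j : Fin 1 => if i.val + j.val + 1 = 1 then (1 : L) else 0)).Local v)))), τ t ∈ Subgroup.centralizer ({εH} : Set (((cmDatum L 2 (Matrix.of fun i j : Fin 2 => if i.val + j.val + 1 = 2 then (1 : L) else 0)).Local v) ×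
      ((cmDatum L 1 (Matrix.of fun i j : Fin 1 => if i.val + j.val + 1 = 1 then (1 : L) else 0)).Local v))))
    (hτ1 : ∀ t : ↥(Subgroup.centralizer ({εH} : Set (((cmDatum L 2 (Matrix.of fun i j : Fin 2 => if i.val + j.val + 1 = 2 then (1 : L) else 0)).Local v) ×
      ((cmDatum L 1 (Matrix.of fun i j : Fin 1 => if i.val + j.val + 1 = 1 then (1 : L) else 0)).Local v)))),
      ((τ t).1.val.val : Matrix (Fin 2) (Fin 2) (LocalRing L v)) * P.val = P.val * Matrix.diagonal ![(P⁻¹.val * t.1.1.val.val * P.val) 0 0, finGammaTwo L v t.1])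
    (hτ2 : ∀ t : ↥(Subgroup.centralizer ({εH} : Set (((cmDatum L 2 (Matrix.of fun i j : Fin 2 => if i.val + j.val + 1 = 2 then (1 : L) else 0)).Local v) ×
      ((cmDatum L 1 (Matrix.of fun i j : Fin 1 => if i.val + j.val + 1 = 1 then (1 : L) else 0)).Local v)))), ((τ t).2.val.val : Matrix (Fin 1) (Fin 1) (LocalRing L v)) = ((P⁻¹.val * t.1.1.val.val * P.val) 1 1) • (1 : Matrix (Fin 1) (Fin 1) (LocalRing L v)))
    -- the dock `θ`
    {ε : ((cmDatum L 3 H').Local v)} (y : GL (Fin 3) (LocalRing L v)) (θ : (((cmDatum L 2 (Matrix.of fun i j : Fin 2 => if i.val + j.val + 1 = 2 then (1 : L) else 0)).Local v) ×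
      ((cmDatum L 1 (Matrix.of fun i j : Fin 1 => if i.val + j.val + 1 = 1 then (1 : L) else 0)).Local v)) ≃ₜ* ↥(Subgroup.centralizer ({ε} : Set ((cmDatum L 3 H').Local v))))
    (hθ : ∀ z : (((cmDatum L 2 (Matrix.of fun i j : Fin 2 => if i.val + j.val + 1 = 2 then (1 : L) else 0)).Local v) ×
      ((cmDatum L 1 (Matrix.of fun i j : Fin 1 => if i.val + j.val + 1 = 1 then (1 : L) else 0)).Local v)), (((θ z).1).val : GL (Fin 3) (LocalRing L v)) = y * ((endoEmbLocal L v z).val : GL (Fin 3) (LocalRing L v)) * y⁻¹)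
    -- the base point
    (b₀ : ↥(Subgroup.centralizer ({εH} : Set (((cmDatum L 2 (Matrix.of fun i j : Fin 2 => if i.val + j.val + 1 = 2 then (1 : L) else 0)).Local v) ×
      ((cmDatum L 1 (Matrix.of fun i j : Fin 1 => if i.val + j.val + 1 = 1 then (1 : L) else 0)).Local v))))) (hb₀ : (b₀ : (((cmDatum L 2 (Matrix.of fun i j : Fin 2 => if i.val + j.val + 1 = 2 then (1 : L) else 0)).Local v) ×
      ((cmDatum L 1 (Matrix.of fun i j : Fin 1 => if i.val + j.val + 1 = 1 then (1 : L) else 0)).Local v))) = εH)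
    -- (J2a) κ-alternation at the torus base
    (halt : ∃ V₁ ∈ 𝓝 b₀, ∀ t ∈ V₁, IsLocalGRegular L v (t : (((cmDatum L 2 (Matrix.of fun i j : Fin 2 => if i.val + j.val + 1 = 2 then (1 : L) else 0)).Local v) ×
      ((cmDatum L 1 (Matrix.of fun i j : Fin 1 => if i.val + j.val + 1 = 1 then (1 : L) else 0)).Local v))) → ∃ d' : ConjClasses (((cmDatum L 2 (Matrix.of fun i j : Fin 2 => if i.val + j.val + 1 = 2 then (1 : L) else 0)).Local v) ×
      ((cmDatum L 1 (Matrix.of fun i j : Fin 1 => if i.val + j.val + 1 = 1 then (1 : L) else 0)).Local v)), d' ≠ ConjClasses.mk (τ t) ∧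
        {d : ConjClasses (((cmDatum L 2 (Matrix.of fun i j : Fin 2 => if i.val + j.val + 1 = 2 then (1 : L) else 0)).Local v) ×
      ((cmDatum L 1 (Matrix.of fun i j : Fin 1 => if i.val + j.val + 1 = 1 then (1 : L) else 0)).Local v)) | IsLocalStablyConjH L v (τ t) (Quotient.out d)} = {ConjClasses.mk (τ t), d'} ∧
        ((finExplicitCollection L H' μ hl hr) v).Δ (t : (((cmDatum L 2 (Matrix.of fun i j : Fin 2 => if i.val + j.val + 1 = 2 then (1 : L) else 0)).Local v) ×
      ((cmDatum L 1 (Matrix.of fun i j : Fin 1 => if i.val + j.val + 1 = 1 then (1 : L) else 0)).Local v))) ((θ (Quotient.out d') : ↥(Subgroup.centralizer ({ε} : Set ((cmDatum L 3 H').Local v)))) : ((cmDatum L 3 H').Local v)) =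
          - ((finExplicitCollection L H' μ hl hr) v).Δ (t : (((cmDatum L 2 (Matrix.of fun i j : Fin 2 => if i.val + j.val + 1 = 2 then (1 : L) else 0)).Local v) ×
      ((cmDatum L 1 (Matrix.of fun i j : Fin 1 => if i.val + j.val + 1 = 1 then (1 : L) else 0)).Local v))) ((θ (Quotient.out (ConjClasses.mk (τ t))) : ↥(Subgroup.centralizer ({ε} : Set ((cmDatum L 3 H').Local v)))) : ((cmDatum L 3 H').Local v))) :
    ∀ ψε : (((cmDatum L 2 (Matrix.of fun i j : Fin 2 => if i.val + j.val + 1 = 2 then (1 : L) else 0)).Local v) ×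
      ((cmDatum L 1 (Matrix.of fun i j : Fin 1 => if i.val + j.val + 1 = 1 then (1 : L) else 0)).Local v)) → ℂ, IsLocSmooth ψε → ∃ V ∈ 𝓝 b₀, ∃ g : ↥(Subgroup.centralizer ({εH} : Set (((cmDatum L 2 (Matrix.of fun i j : Fin 2 => if i.val + j.val + 1 = 2 then (1 : L) else 0)).Local v) ×
      ((cmDatum L 1 (Matrix.of fun i j : Fin 1 => if i.val + j.val + 1 = 1 then (1 : L) else 0)).Local v)))) → ℂ, IsLocallyConstant g ∧
      ∀ t ∈ V, IsLocalGRegular L v (t : (((cmDatum L 2 (Matrix.of fun i j : Fin 2 => if i.val + j.val + 1 = 2 then (1 : L) else 0)).Local v) ×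
      ((cmDatum L 1 (Matrix.of fun i j : Fin 1 => if i.val + j.val + 1 = 1 then (1 : L) else 0)).Local v))) →
        (∑ᶠ d ∈ {d : ConjClasses (((cmDatum L 2 (Matrix.of fun i j : Fin 2 => if i.val + j.val + 1 = 2 then (1 : L) else 0)).Local v) ×
      ((cmDatum L 1 (Matrix.of fun i j : Fin 1 => if i.val + j.val + 1 = 1 then (1 : L) else 0)).Local v)) | IsLocalStablyConjH L v (τ t) (Quotient.out d)},
          ((finExplicitCollection L H' μ hl hr) v).Δ (t : (((cmDatum L 2 (Matrix.of fun i j : Fin 2 => if i.val + j.val + 1 = 2 then (1 : L) else 0)).Local v) ×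
      ((cmDatum L 1 (Matrix.of fun i j : Fin 1 => if i.val + j.val + 1 = 1 then (1 : L) else 0)).Local v))) ((θ (Quotient.out d) : ↥(Subgroup.centralizer ({ε} : Set ((cmDatum L 3 H').Local v)))) : ((cmDatum L 3 H').Local v)) * classOrbitalIntegral mH ψε d) = g t := by
  haveI hv : Subsingleton (PlacesOver L v) :=
    PlacesOver.subsingleton_of_smul_eq (IsCMField.complexConj L) (IsCMField.complexConj_ne_one L) w hw
  refine exists_nhds_finsum_delta_dock_eq_locallyConstant_of_torusTransfer L H' v μ hl hr mH εH b₀ θ τ hτc hτreg εH hτC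
    (fun h : (((cmDatum L 2 (Matrix.of fun i j : Fin 2 => if i.val + j.val + 1 = 2 then (1 : L) else 0)).Local v) ×
      ((cmDatum L 1 (Matrix.of fun i j : Fin 1 => if i.val + j.val + 1 = 1 then (1 : L) else 0)).Local v)) =>
      ((finHeckeValue L v μ
          (((P⁻¹).val * (h.1.val.val : Matrix (Fin 2) (Fin 2) (LocalRing L v)) * P.val) 0 0 - ((P⁻¹).val * (h.1.val.val : Matrix (Fin 2) (Fin 2) (LocalRing L v)) * P.val) 1 1))⁻¹ : ℂ) *
        ((Real.sqrt (∏ w' : PlacesOver L v,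
            ‖(((P⁻¹).val * (h.1.val.val : Matrix (Fin 2) (Fin 2) (LocalRing L v)) * P.val) 0 0 - ((P⁻¹).val * (h.1.val.val : Matrix (Fin 2) (Fin 2) (LocalRing L v)) * P.val) 1 1) w'‖) : ℝ) : ℂ))
    ?_ halt
    (exists_nhds_finExplicitCollection_Δ_dock_eq_mul_rankOneWeight L H' v w hw μ hl hr εH P dg hP hdg0 hdg01 ht1 τ hτ1 hτ2 y θ hθ b₀ hb₀)
  -- (R1-lc) on `C = Z_H(ε_H)` with `Reg := IsLocalGRegular L v`
  intro ψε hψε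
  obtain ⟨fC, hlc, -, hfC⟩ := hR1lc L v hv μ νH mH (IsLocalGRegular L v)
    (fun γ hγ => (isRegularElt_fst_snd_of_isLocalGRegular L v γ hγ).1) (fun γ x hγ => (isLocalGRegular_conj_iff L x γ).2 hγ)
    hmH ψε hψε εH P dg hregA hP
  exact ⟨fC, hlc, hfC⟩

end TorusUnstableClosed

end Literature.NumberTheory.Rogawski1990

end
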